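import Literature.Topology.FourManifolds.ChordPiece
import HarnessLib

/-!
# The in-band hairpin: a southern U-turn between the two necks

Topic `Literature/Topology/FourManifolds` (trunk T-4MAN). Fact seat
`provefact-Literature.Topology.FourManifolds.Knot.IsConnectedSum.isIsotopic` (Schubert's theorem),
geometric heart for rail knots, deep-chord design (companion of `ChordPiece.lean`). The foreign
closing arc of a datum `b` at the neck scale `κ` consists of the lower flat neck (with its chord),
a **U-turn inside the band** from the lower neck line `x₁ = 1/2 - κ` to the upper neck line
`x₁ = 1/2 + κ` on the right of the crossing, and the upper flat neck back. This file builds the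
U-turn as the band image of an explicit planar path and records what the frames need.

* `hairpinModel s = (3 + 4 s (1 - s), -1 + 2 χ s)` (`χ = smoothStep (1/3) (2/3)`), in blow-up
  planar units: on `[0, 1/3]` it runs along the lower model neck line `x₁ = -1` with the first
  coordinate increasing from `3`, on `[2/3, 1]` back along the upper line `x₁ = 1`, and in between
  the second coordinate is strictly increasing (`hairpinModel_of_le`, `hairpinModel_of_ge`); it
  is `C^∞`, injective on `[0, 1]`, regular, with first coordinate in `[3, 4]` and norm `≤ 5`.
* `hairpinParam κ s = κ • hairpinModel s` (relative planar parameter, norm `≤ 5κ`) and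
  `b.hairpin κ s = Fband (hairpinParam κ s)` (chart point): equal to `railLoPsi κ (X s)` for
  `s ≤ 1/3` and to `railHiPsi κ (X s)` for `s ≥ 2/3`; exactly in the open southern chart ball
  (`norm_hairpin_lt_two`, `B` south); within blow-up distance `5 ε` of `(X s, V s, 0)` in the
  flat regime (`norm_blowUp_hairpin_sub_le`), hence first blow-up coordinate `≥ 3 - 5ε` and
  distance `≤ 9κ‖frame‖` from `pZero`; `C^∞` and regular (flatness of the differential);
  injective on `[0, 1]` (band injectivity).

Everything is proved; no named facts are introduced.

## References

Standard; all statements `[folklore]`.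
-/

open scoped Manifold ContDiff Topology Real
open Function Set Metric Filter

noncomputable section

namespace Literature.Topology.FourManifolds

/-- Local notation: `𝔼 n` is the model Euclidean space `EuclideanSpace ℝ (Fin n)`. -/
local notation "𝔼 " n:arg => EuclideanSpace ℝ (Fin n)

/-- Local notation: `𝕊 n` is the unit sphere in `EuclideanSpace ℝ (Fin (n + 1))`. -/
local notation "𝕊 " n:arg => (Metric.sphere (0 : EuclideanSpace ℝ (Fin (n + 1))) 1)

attribute [local instance] fact_finrank_euclideanSpace_succ

open KnotsInBall

/-! ### The planar model of the hairpin -/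

/-- First coordinate of the hairpin model: `3 + 4 s (1 - s)`. [folklore] -/
def hairpinX (s : ℝ) : ℝ := 3 + 4 * s * (1 - s)

/-- Second coordinate of the hairpin model: `-1 + 2 χ s`, `χ = smoothStep (1/3) (2/3)`. [folklore] -/
def hairpinV (s : ℝ) : ℝ := -1 + 2 * smoothStep (1 / 3) (2 / 3) s

/-- **The hairpin model** in blow-up planar units. [folklore] -/
def hairpinModel (s : ℝ) : 𝔼 2 := pt2 (hairpinX s) (hairpinV s)

/-- First coordinate of the hairpin model. [folklore] -/
@[simp] theorem hairpinModel_apply_zero (s : ℝ) : hairpinModel s 0 = hairpinX s := rfl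

/-- Second coordinate of the hairpin model. [folklore] -/
@[simp] theorem hairpinModel_apply_one (s : ℝ) : hairpinModel s 1 = hairpinV s := rfl

/-- The first coordinate is `C^∞`. [folklore] -/
theorem contDiff_hairpinX : ContDiff ℝ ∞ hairpinX := by
  unfold hairpinX; fun_prop

/-- The second coordinate is `C^∞`. [folklore] -/
theorem contDiff_hairpinV : ContDiff ℝ ∞ hairpinV :=
  contDiff_const.add (contDiff_const.mul (contDiff_smoothStep _ _))

/-- The hairpin model is `C^∞`. [folklore] -/
theorem contDiff_hairpinModel : ContDiff ℝ ∞ hairpinModel := by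
  rw [contDiff_euclidean]
  intro i; fin_cases i
  · exact contDiff_hairpinX
  · exact contDiff_hairpinV

/-- The first coordinate has derivative `4 (1 - 2 s)`. [folklore] -/
theorem hasDerivAt_hairpinX (s : ℝ) : HasDerivAt hairpinX (4 * (1 - 2 * s)) s := by
  have h := (((hasDerivAt_id s).const_mul 4).mul ((hasDerivAt_id s).const_sub 1)).const_add 3
  have e : hairpinX = fun x ↦ 3 + 4 * id x * (1 - id x) := rfl
  rw [e]
  exact h.congr_deriv (by simp only [id]; ring)

/-- The second coordinate has derivative `2 χ'`. [folklore] -/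
theorem hasDerivAt_hairpinV (s : ℝ) : HasDerivAt hairpinV (2 * deriv (smoothStep (1 / 3) (2 / 3)) s) s :=
  (((differentiable_smoothStep _ _) s).hasDerivAt.const_mul 2).const_add _

/-- Left of `1/3` the second coordinate is `-1`. [folklore] -/
theorem hairpinV_of_le {s : ℝ} (hs : s ≤ 1 / 3) : hairpinV s = -1 := by
  rw [hairpinV, smoothStep_of_le (by norm_num) hs]; ring

/-- Right of `2/3` the second coordinate is `1`. [folklore] -/
theorem hairpinV_of_ge {s : ℝ} (hs : 2 / 3 ≤ s) : hairpinV s = 1 := by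
  rw [hairpinV, smoothStep_of_ge (by norm_num) hs]; ring

/-- The second coordinate lies in `[-1, 1]`. [folklore] -/
theorem hairpinV_mem (s : ℝ) : hairpinV s ∈ Icc (-1 : ℝ) 1 := by
  have h := smoothStep_mem_Icc (1 / 3) (2 / 3) s
  rw [hairpinV]; constructor <;> linarith [h.1, h.2]

/-- Strictly between `1/3` and `2/3` the second coordinate lies in `(-1, 1)`. [folklore] -/
theorem hairpinV_mem_Ioo {s : ℝ} (hs : s ∈ Ioo (1 / 3 : ℝ) (2 / 3)) : hairpinV s ∈ Ioo (-1 : ℝ) 1 := by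
  have h := smoothStep_mem_Ioo (show (1 / 3 : ℝ) < 2 / 3 by norm_num) hs
  rw [hairpinV]; constructor <;> linarith [h.1, h.2]

/-- The second coordinate is strictly increasing on `[1/3, 2/3]`. [folklore] -/
theorem strictMonoOn_hairpinV : StrictMonoOn hairpinV (Icc (1 / 3) (2 / 3)) := fun s hs t ht hst ↦ by
  have := strictMonoOn_smoothStep (show (1 / 3 : ℝ) < 2 / 3 by norm_num) hs ht hst
  rw [hairpinV, hairpinV]; linarith

/-- The second coordinate is monotone. [folklore] -/
theorem monotone_hairpinV : Monotone hairpinV := fun s t hst ↦ by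
  have := monotone_smoothStep (show (1 / 3 : ℝ) ≤ 2 / 3 by norm_num) hst
  rw [hairpinV, hairpinV]; linarith

/-- The first coordinate lies in `[3, 4]` on `[0, 1]`. [folklore] -/
theorem hairpinX_mem {s : ℝ} (hs : s ∈ Icc (0 : ℝ) 1) : hairpinX s ∈ Icc (3 : ℝ) 4 := by
  rw [hairpinX]; constructor <;> nlinarith [hs.1, hs.2, sq_nonneg (s - 1 / 2)]

/-- The first coordinate is strictly increasing on `[0, 1/2]`. [folklore] -/
theorem strictMonoOn_hairpinX : StrictMonoOn hairpinX (Icc 0 (1 / 2)) := fun s hs t ht hst ↦ by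
  rw [hairpinX, hairpinX]; nlinarith [hs.1, ht.2]

/-- The first coordinate is strictly decreasing on `[1/2, 1]`. [folklore] -/
theorem strictAntiOn_hairpinX : StrictAntiOn hairpinX (Icc (1 / 2) 1) := fun s hs t ht hst ↦ by
  rw [hairpinX, hairpinX]; nlinarith [hs.1, ht.2]

/-- On `[0, 1/3]` the hairpin model is on the lower model line. [folklore] -/
theorem hairpinModel_of_le {s : ℝ} (hs : s ≤ 1 / 3) : hairpinModel s = pt2 (hairpinX s) (-1) := by
  rw [hairpinModel, hairpinV_of_le hs]

/-- On `[2/3, 1]` the hairpin model is on the upper model line. [folklore] -/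
theorem hairpinModel_of_ge {s : ℝ} (hs : 2 / 3 ≤ s) : hairpinModel s = pt2 (hairpinX s) 1 := by
  rw [hairpinModel, hairpinV_of_ge hs]

/-- **The hairpin model is injective on `[0, 1]`.** [folklore] -/
theorem injOn_hairpinModel : InjOn hairpinModel (Icc 0 1) := by
  intro s hs t ht hst
  have hX : hairpinX s = hairpinX t := by simpa using congrArg (fun p : 𝔼 2 ↦ p 0) hst
  have hV : hairpinV s = hairpinV t := by simpa using congrArg (fun p : 𝔼 2 ↦ p 1) hst
  -- the second coordinate decides the zone
  by_contra hne
  rcases lt_or_gt_of_ne hne with hlt | hlt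
  · -- `s < t`
    rcases le_or_gt t (1 / 2) with ht2 | ht2
    · exact absurd hX (strictMonoOn_hairpinX ⟨hs.1, by linarith⟩ ⟨ht.1, ht2⟩ hlt).ne
    rcases le_or_gt (1 / 2) s with hs2 | hs2
    · exact absurd hX (strictAntiOn_hairpinX ⟨hs2, hs.2⟩ ⟨by linarith, ht.2⟩ hlt).ne'
    -- `s < 1/2 < t`: then `V s ≤ V (1/2) ≤ V t` with one inequality strict
    have h1 : hairpinV s < hairpinV (1 / 2) := by
      rcases le_or_gt s (1 / 3) with h | h
      · rw [hairpinV_of_le h]; exact (hairpinV_mem_Ioo ⟨by norm_num, by norm_num⟩).1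
      · exact strictMonoOn_hairpinV ⟨h.le, by linarith⟩ ⟨by norm_num, by norm_num⟩ hs2
    have h2 : hairpinV (1 / 2) ≤ hairpinV t := monotone_hairpinV ht2.le
    linarith
  · rcases le_or_gt s (1 / 2) with hs2 | hs2
    · exact absurd hX (strictMonoOn_hairpinX ⟨ht.1, by linarith⟩ ⟨hs.1, hs2⟩ hlt).ne'
    rcases le_or_gt (1 / 2) t with ht2 | ht2
    · exact absurd hX (strictAntiOn_hairpinX ⟨ht2, ht.2⟩ ⟨by linarith, hs.2⟩ hlt).ne
    have h1 : hairpinV t < hairpinV (1 / 2) := by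
      rcases le_or_gt t (1 / 3) with h | h
      · rw [hairpinV_of_le h]; exact (hairpinV_mem_Ioo ⟨by norm_num, by norm_num⟩).1
      · exact strictMonoOn_hairpinV ⟨h.le, by linarith⟩ ⟨by norm_num, by norm_num⟩ ht2
    have h2 : hairpinV (1 / 2) ≤ hairpinV s := monotone_hairpinV hs2.le
    linarith

/-- **The hairpin model is regular**: its derivative is the nonzero vector `(X', V')`. [folklore] -/
theorem hasDerivAt_hairpinModel (s : ℝ) :
    HasDerivAt hairpinModel (pt2 (4 * (1 - 2 * s)) (2 * deriv (smoothStep (1 / 3) (2 / 3)) s)) s :=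
  hasDerivAt_pt2 (hasDerivAt_hairpinX s) (hasDerivAt_hairpinV s)

/-- The derivative of the hairpin model is nonzero. [folklore] -/
theorem deriv_hairpinModel_ne_zero (s : ℝ) : deriv hairpinModel s ≠ 0 := by
  rw [(hasDerivAt_hairpinModel s).deriv]
  intro h
  have h0 : 4 * (1 - 2 * s) = 0 := by simpa using congrArg (fun p : 𝔼 2 ↦ p 0) h
  have h1 : 2 * deriv (smoothStep (1 / 3) (2 / 3)) s = 0 := by simpa using congrArg (fun p : 𝔼 2 ↦ p 1) h
  have hs : s = 1 / 2 := by linarith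
  have := deriv_smoothStep_pos (show (1 / 3 : ℝ) < 2 / 3 by norm_num) (x := s) ⟨by rw [hs]; norm_num, by rw [hs]; norm_num⟩
  linarith

/-- The norm of the hairpin model is at most `5` on `[0, 1]`. [folklore] -/
theorem norm_hairpinModel_le {s : ℝ} (hs : s ∈ Icc (0 : ℝ) 1) : ‖hairpinModel s‖ ≤ 5 := by
  have hX := hairpinX_mem hs
  have hV := hairpinV_mem s
  refine (BandData.norm_pt2_le _ _).trans ?_
  rw [abs_of_pos (by linarith [hX.1])]
  have : |hairpinV s| ≤ 1 := abs_le.2 ⟨hV.1, hV.2⟩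
  linarith [hX.2]

/-! ### The planar parameter of the hairpin -/

/-- **The planar parameter of the hairpin** (relative to the centre of the band): `κ • model`.
[folklore] -/
def hairpinParam (κ s : ℝ) : 𝔼 2 := κ • hairpinModel s

/-- The norm of the planar parameter is at most `5κ` on `[0, 1]`. [folklore] -/
theorem norm_hairpinParam_le {κ : ℝ} (hκ : 0 < κ) {s : ℝ} (hs : s ∈ Icc (0 : ℝ) 1) : ‖hairpinParam κ s‖ ≤ κ * 5 := by
  rw [hairpinParam, norm_smul, Real.norm_eq_abs, abs_of_pos hκ]
  exact mul_le_mul_of_nonneg_left (norm_hairpinModel_le hs) hκ.le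

/-- The first planar coordinate of the parameter is `κ X s`. [folklore] -/
theorem hairpinParam_apply_zero (κ s : ℝ) : hairpinParam κ s 0 = κ * hairpinX s := by
  simp [hairpinParam]

/-- On `[0, 1/3]` the planar parameter is the lower rail parameter at `α = X s`. [folklore] -/
theorem hairpinParam_of_le {κ s : ℝ} (hs : s ≤ 1 / 3) : hairpinParam κ s = pt2 (κ * hairpinX s) (-κ) := by
  rw [hairpinParam, hairpinModel_of_le hs]
  ext i; fin_cases i <;> simp

/-- On `[2/3, 1]` the planar parameter is the upper rail parameter at `α = X s`. [folklore] -/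
theorem hairpinParam_of_ge {κ s : ℝ} (hs : 2 / 3 ≤ s) : hairpinParam κ s = pt2 (κ * hairpinX s) κ := by
  rw [hairpinParam, hairpinModel_of_ge hs]
  ext i; fin_cases i <;> simp

/-- The planar parameter is `C^∞`. [folklore] -/
theorem contDiff_hairpinParam (κ : ℝ) : ContDiff ℝ ∞ (hairpinParam κ) := by
  unfold hairpinParam; exact (contDiff_const (c := κ)).smul contDiff_hairpinModel

/-- The planar parameter has derivative `κ • model'`. [folklore] -/
theorem hasDerivAt_hairpinParam (κ s : ℝ) :
    HasDerivAt (hairpinParam κ) (κ • pt2 (4 * (1 - 2 * s)) (2 * deriv (smoothStep (1 / 3) (2 / 3)) s)) s :=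
  (hasDerivAt_hairpinModel s).const_smul κ

/-- **The planar parameter is injective on `[0, 1]`** (`κ ≠ 0`). [folklore] -/
theorem injOn_hairpinParam {κ : ℝ} (hκ : κ ≠ 0) : InjOn (hairpinParam κ) (Icc 0 1) := fun _ hs _ ht h ↦
  injOn_hairpinModel hs ht (smul_right_injective (𝔼 2) hκ h)

namespace BandData

variable {A B K : Knot} {avoid : Set (𝕊 3)} (b : BandData A B K avoid)
  (hcross : b.band ⁻¹' sphereEquator 2 ∩ squareNhd b.δ = {x ∈ squareNhd b.δ | x 0 = 2⁻¹})

/-! ### The hairpin in the band -/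

omit hcross in
/-- **The hairpin read in the chart**: `Fband (hairpinParam κ s)`. [folklore] -/
def hairpin (κ s : ℝ) : 𝔼 3 := b.Fband (hairpinParam κ s)

omit hcross in
/-- **On `[0, 1/3]` the hairpin is the lower rail** at the blown-up parameter `X s`. [folklore] -/
theorem hairpin_of_le {κ s : ℝ} (hs : s ≤ 1 / 3) : b.hairpin κ s = b.railLoPsi κ (hairpinX s) := by
  rw [hairpin, hairpinParam_of_le hs]; rfl

omit hcross in
/-- **On `[2/3, 1]` the hairpin is the upper rail** at the blown-up parameter `X s`. [folklore] -/
theorem hairpin_of_ge {κ s : ℝ} (hs : 2 / 3 ≤ s) : b.hairpin κ s = b.railHiPsi κ (hairpinX s) := by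
  rw [hairpin, hairpinParam_of_ge hs]; rfl

/-! ### The hairpin is south, flat and regular -/

include hcross in
/-- **The hairpin is exactly in the open southern chart ball** (`B` south, `5κ < 1/2`). [folklore] -/
theorem norm_hairpin_lt_two (hB : B.InSouth) {κ : ℝ} (hκ : 0 < κ) (hκ5 : κ * 5 < 2⁻¹) {s : ℝ} (hs : s ∈ Icc (0 : ℝ) 1) :
    ‖b.hairpin κ s‖ < 2 := by
  have hq : ‖hairpinParam κ s‖ < 2⁻¹ := (norm_hairpinParam_le hκ hs).trans_lt hκ5
  have h0 : 0 < hairpinParam κ s 0 := by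
    rw [hairpinParam_apply_zero]; exact mul_pos hκ (by linarith [(hairpinX_mem hs).1])
  exact b.norm_Fband_lt_two (hcross := hcross) hB hq h0

include hcross in
/-- **The hairpin on the sphere is in the open southern hemisphere.** [folklore] -/
theorem coe_psiN_symm_hairpin_last_neg (hB : B.InSouth) {κ : ℝ} (hκ : 0 < κ) (hκ5 : κ * 5 < 2⁻¹) {s : ℝ}
    (hs : s ∈ Icc (0 : ℝ) 1) : ((psiN.symm (b.hairpin κ s) : 𝕊 3) : 𝔼 4) (Fin.last 3) < 0 := by
  have h := b.norm_hairpin_lt_two hcross hB hκ hκ5 hs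
  rw [← psiN_apply_psiN_symm (b.hairpin κ s)] at h
  exact (norm_psiN_lt_two_iff (psiN_symm_ne_northPole _)).1 h

section Flat

variable {hcross} {ε r κ : ℝ} (hf : b.IsFlat hcross ε r) (hκ : 0 < κ) (h5 : κ * 5 < r)
include hf hκ h5

omit hf in
/-- The planar parameter lies within the flatness radius on `[0, 1]`. [folklore] -/
theorem norm_hairpinParam_lt {s : ℝ} (hs : s ∈ Icc (0 : ℝ) 1) : ‖hairpinParam κ s‖ < r :=
  (norm_hairpinParam_le hκ hs).trans_lt h5

/-- **The hairpin in blow-up coordinates is within `5 ε` of the model** `(X s, V s, 0)`. [folklore] -/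
theorem norm_blowUp_hairpin_sub_le {s : ℝ} (hs : s ∈ Icc (0 : ℝ) 1) :
    ‖b.blowUp hcross κ (b.hairpin κ s) - pt3 (hairpinX s) (hairpinV s) 0‖ ≤ 5 * ε := by
  have hq := norm_hairpinParam_lt hκ h5 hs
  have key := hf.flat (hairpinParam κ s) 0 hq (by simpa using hf.r_pos)
  have hF0 : b.Fband 0 = b.pZero := rfl
  rw [hF0, sub_zero] at key
  have e : b.blowUp hcross κ (b.hairpin κ s) - pt3 (hairpinX s) (hairpinV s) 0 =
      κ⁻¹ • ((b.frame hcross).symm (b.Fband (hairpinParam κ s) - b.pZero) -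
        WithLp.toLp 2 ![(hairpinParam κ s) 0 - (0 : 𝔼 2) 0, (hairpinParam κ s) 1 - (0 : 𝔼 2) 1, 0]) := by
    rw [smul_sub, blowUp, hairpin]
    congr 1
    ext i; fin_cases i <;> simp [hairpinParam, hκ.ne']
  rw [e, norm_smul, Real.norm_eq_abs, abs_inv, abs_of_pos hκ]
  have hε : 0 ≤ ε := hf.eps_nonneg
  calc κ⁻¹ * _ ≤ κ⁻¹ * (ε * ‖hairpinParam κ s‖) := by gcongr
    _ ≤ κ⁻¹ * (ε * (κ * 5)) := by gcongr; exact norm_hairpinParam_le hκ hs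
    _ = 5 * ε := by field_simp

/-- Coordinates of the hairpin in blow-up coordinates: `|Y₀ - X|, |Y₁ - V|, |Y₂| ≤ 5 ε`. [folklore] -/
theorem blowUp_hairpin_coord {s : ℝ} (hs : s ∈ Icc (0 : ℝ) 1) :
    |b.blowUp hcross κ (b.hairpin κ s) 0 - hairpinX s| ≤ 5 * ε ∧
      |b.blowUp hcross κ (b.hairpin κ s) 1 - hairpinV s| ≤ 5 * ε ∧
        |b.blowUp hcross κ (b.hairpin κ s) 2| ≤ 5 * ε := by
  have h := b.norm_blowUp_hairpin_sub_le hf hκ h5 hs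
  refine ⟨?_, ?_, ?_⟩
  · have := (BandFoliation.abs_apply_le_norm _ 0).trans h; simpa using this
  · have := (BandFoliation.abs_apply_le_norm _ 1).trans h; simpa using this
  · have := (BandFoliation.abs_apply_le_norm _ 2).trans h; simpa using this

/-- **The first blow-up coordinate of the hairpin is at least `3 - 5 ε`.** [folklore] -/
theorem blowUp_hairpin_zero_ge {s : ℝ} (hs : s ∈ Icc (0 : ℝ) 1) : 3 - 5 * ε ≤ b.blowUp hcross κ (b.hairpin κ s) 0 := by
  have h := (b.blowUp_hairpin_coord hf hκ h5 hs).1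
  linarith [(abs_le.1 h).1, (hairpinX_mem hs).1]

/-- The hairpin stays within blow-up norm `5 + 5 ε`. [folklore] -/
theorem norm_blowUp_hairpin_le {s : ℝ} (hs : s ∈ Icc (0 : ℝ) 1) : ‖b.blowUp hcross κ (b.hairpin κ s)‖ ≤ 5 + 5 * ε := by
  have h := b.norm_blowUp_hairpin_sub_le hf hκ h5 hs
  have hX := hairpinX_mem hs
  have hV := hairpinV_mem s
  have h0 : ‖(pt3 (hairpinX s) (hairpinV s) 0 : 𝔼 3)‖ ≤ 5 := by
    refine (norm_pt3_le _ _ _).trans ?_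
    rw [abs_of_pos (by linarith [hX.1]), abs_zero]
    have : |hairpinV s| ≤ 1 := abs_le.2 ⟨hV.1, hV.2⟩
    linarith [hX.2]
  have := norm_sub_norm_le (b.blowUp hcross κ (b.hairpin κ s)) (pt3 (hairpinX s) (hairpinV s) 0)
  linarith

/-- **The hairpin is within `9κ ‖frame‖` of `pZero`** (`ε ≤ 4/5`). [folklore] -/
theorem norm_hairpin_sub_pZero_le {s : ℝ} (hs : s ∈ Icc (0 : ℝ) 1) (hε : ε ≤ 4 / 5) :
    ‖b.hairpin κ s - b.pZero‖ ≤ 9 * κ * ‖((b.frame hcross : (𝔼 3) ≃L[ℝ] 𝔼 3) : (𝔼 3) →L[ℝ] 𝔼 3)‖ := by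
  have h1 := b.norm_sub_pZero_le hκ (hcross := hcross) (b.hairpin κ s)
  have h2 := b.norm_blowUp_hairpin_le hf hκ h5 hs
  calc _ ≤ κ * ‖((b.frame hcross : (𝔼 3) ≃L[ℝ] 𝔼 3) : (𝔼 3) →L[ℝ] 𝔼 3)‖ * ‖b.blowUp hcross κ (b.hairpin κ s)‖ := h1
    _ ≤ κ * ‖((b.frame hcross : (𝔼 3) ≃L[ℝ] 𝔼 3) : (𝔼 3) →L[ℝ] 𝔼 3)‖ * 9 :=
        mul_le_mul_of_nonneg_left (by linarith) (mul_nonneg hκ.le (norm_nonneg _))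
    _ = _ := by ring

/-- **The hairpin is `C^∞`** on a neighbourhood of `[0, 1]` (at every `s ∈ [0, 1]`). [folklore] -/
theorem contDiffAt_hairpin {s : ℝ} (hs : s ∈ Icc (0 : ℝ) 1) : ContDiffAt ℝ ∞ (b.hairpin κ) s :=
  (b.contDiffAt_Fband hcross ((norm_hairpinParam_lt hκ h5 hs).trans_le hf.r_le)).comp s
    (contDiff_hairpinParam κ).contDiffAt

/-- **The hairpin is regular on `[0, 1]`** (`ε < 1`): the differential of `Fband` is injective in
the flat regime and the planar parameter is regular. [folklore] -/
theorem deriv_hairpin_ne_zero (hε1 : ε < 1) {s : ℝ} (hs : s ∈ Icc (0 : ℝ) 1) : deriv (b.hairpin κ) s ≠ 0 := by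
  have hq := norm_hairpinParam_lt hκ h5 hs
  set w : 𝔼 2 := κ • pt2 (4 * (1 - 2 * s)) (2 * deriv (smoothStep (1 / 3) (2 / 3)) s) with hw
  have hw0 : w ≠ 0 := by
    rw [hw]; refine smul_ne_zero hκ.ne' ?_
    have := deriv_hairpinModel_ne_zero s
    rwa [(hasDerivAt_hairpinModel s).deriv] at this
  have hF := (b.differentiableAt_Fband hcross (hq.trans_le hf.r_le)).hasFDerivAt
  have hd : HasDerivAt (b.hairpin κ) (fderiv ℝ b.Fband (hairpinParam κ s) w) s :=
    hF.comp_hasDerivAt s (hasDerivAt_hairpinParam κ s)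
  rw [hd.deriv]
  intro h0
  have key := hf.flat_fderiv _ hq w
  rw [h0, map_zero, zero_sub, norm_neg] at key
  -- `‖(w₀, w₁, 0)‖ = ‖w‖ ≤ ε ‖w‖ < ‖w‖`
  have hn : ‖(WithLp.toLp 2 ![w 0, w 1, 0] : 𝔼 3)‖ = ‖w‖ := norm_inl_eq w
  rw [hn] at key
  have hwpos : 0 < ‖w‖ := norm_pos_iff.2 hw0
  nlinarith

/-- **The hairpin is injective on `[0, 1]`**: band injectivity on the square neighbourhood
(`5κ < 1/2`). [folklore] -/
theorem injOn_hairpin (hκ5 : κ * 5 < 2⁻¹) : InjOn (b.hairpin κ) (Icc 0 1) := by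
  intro s hs t ht h
  have hqs : ‖hairpinParam κ s‖ < 2⁻¹ := (norm_hairpinParam_le hκ hs).trans_lt hκ5
  have hqt : ‖hairpinParam κ t‖ < 2⁻¹ := (norm_hairpinParam_le hκ ht).trans_lt hκ5
  have hps := (b.poleRad_pos hcross)
  have h1 : b.band (pt2 2⁻¹ 2⁻¹ + hairpinParam κ s) = b.band (pt2 2⁻¹ 2⁻¹ + hairpinParam κ t) := by
    have hs' := b.band_ne_northPole_of_norm_lt hcross ((norm_hairpinParam_lt hκ h5 hs).trans_le hf.r_le)
    have ht' := b.band_ne_northPole_of_norm_lt hcross ((norm_hairpinParam_lt hκ h5 ht).trans_le hf.r_le)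
    have := congrArg psiN.symm h
    rwa [hairpin, hairpin, Fband, Fband, psiN_symm_apply_psiN hs', psiN_symm_apply_psiN ht'] at this
  have h2 := b.injOn (b.centre_add_mem_squareNhd hqs) (b.centre_add_mem_squareNhd hqt) h1
  exact injOn_hairpinParam hκ.ne' hs ht (add_left_cancel h2)

end Flat

end BandData

end Literature.Topology.FourManifolds
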